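/-
Copyright (c) 2026 the pub-hodgecm-mathlib formalisation cell (harness21).  Prover seat hodgecm-mathlib-K2Liu-p11 (g2), Track B «K2-LIT»,
#184♮ = hLiu418 = `stmt-HodgeConjecture-24832`; LEAD F0P6-plan (g13) 10:02:45Z∕10:13:40Z «(A∞-R)∕(A∞-½) consumer faces» + (F-a) 09:54:40Z
(U1-glob(σ) arch clause RE-TYPED SECTION-LEVEL).  THEOREMS ONLY (no `def`, no `instance`, no notation, no named-fact hypothesis, no `sorry`).
-/
import Summits.HodgeConjecture.HodgeConjecture.Theorems.K2LiuArchScalarSectionUnique     -- ★ (this lineage): uniqueness∕transfer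
import Summits.HodgeConjecture.HodgeConjecture.Theorems.K2LiuArchNormalisedScalarCont    -- ★ (this lineage): `n_k` continued + (L1′)(L2)(L3)
import Summits.HodgeConjecture.HodgeConjecture.Theorems.K2LiuArchIntertwiningRightEquivariance   -- ★ (this lineage): `archIntertwining_const_mul`
import Mathlib.Analysis.SpecialFunctions.Pow.Deriv
import Mathlib.Analysis.Complex.CauchyIntegral
import Mathlib.Analysis.Analytic.Uniqueness
import HarnessLib

/-!
# Crux `HLiu418`, A∞ organ: the CONTINUED normalised operator at `s = ½` on scalar `K_w`-types — the (A∞-R)∕(A∞-½) consumer faces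

Cell `hodgecm-mathlib`, crux item hLiu418 = `stmt-HodgeConjecture-24832` (helper lane `--supports`, count-neutral).

The A∞ letters live on the half-plane of absolute convergence `re s > ½` (★ (L1′)
`archIntertwiningNormalized_archScalarSection_eq_cont : M*_w(s) f⁰_{s,k} = n_k(s) · f⁰_{−s,k}`), while every consumer — the arch clause of
U1-glob(σ) in LEAD's (F-a) bytes («every flat family `b_s` through `b` and every `Fn` with `archIntertwiningNormalized s (b_s ·) = Fn s` on
`½ < re s` and `DifferentiableOn ℂ (Fn · h) {0 < re s}` → `Fn (1∕2) = 0`»), (A-int-arch), (CR) — evaluates a CONTINUATION `Fn` AT `s = ½`.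
This file is the identity-theorem transport, typed once, SECTION-LEVEL, on the scalar `K_w`-types:

* data: `k : ℤ`, `c : ℂ`, `h ∈ U(2,2)` (`hᴴ J h = J`), a family `F : ℂ → (M₄(ℂ) → ℂ)` which for `½ < re s` has the scalar parabolic law
  `IsArchSiegelSection χ_k s (F s)`, the scalar `K_w`-type `F s (g u) = j(u,i1)^{−k} F s g` (`u ∈ Stab(i1)`) and the flat normalisation
  `F s 1 = c` (so `F s = c · f⁰_{s,k}` on `U(J)`, ★ `eq_mul_archScalarSection`), and a scalar continuation `Fn : ℂ → ℂ`, holomorphic on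
  `{0 < re s}`, with `Fn s = archIntertwiningNormalized s (F s) h` for `½ < re s`;
* §0 `differentiable_archScalarSection_param` (`s ↦ f⁰_{s,k}(h)` is entire, generic rank) and `differentiableOn_contClosedForm`
  (`s ↦ c · n_k(s) · f⁰_{−s,k}(h)` is holomorphic on `{0 < re s}` for odd `k`, ★ (L2));
* §1 `eq_contClosedForm_of_re_pos (hk : Odd k) … (hs : 0 < re s) : Fn s = c · n_k(s) · f⁰_{−s,k}(h)` — the continuation IS the closed
  form on the whole of `{0 < re s}` (Mathlib `AnalyticOnNhd.eqOn_of_preconnected_of_eventuallyEq` on the convex half-plane);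
* §2 the faces at `½`: **(A∞-½ ∕ U1-arch kernel)** `half_eq_zero (hk : Odd k) (h1 : k.natAbs ≠ 1) : Fn (1∕2) = 0` (★ (L3b)) and
  **(A∞-R ∕ A-int-arch at ½)** `half_eq_of_natAbs_eq_one (h1 : k.natAbs = 1) : Fn (1∕2) = c · f⁰_{−½,k}(h)` (★ (L3a):
  `M*_σ(½) f = f(1) · f⁰_{−½,±1}` on the pinned Gaussian line);
* §3 the same with the EXPLICIT flat family `F s := c · archScalarSection k s` (nothing to discharge) and the function-level corollaries
  (`Fn : ℂ → M₄(ℂ) → ℂ`, conclusions `∀ h ∈ U(J)`).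
Even `k` (the pole class: ★ `regularPart_half_ne_zero_of_even`) is deliberately not faced — no consumer.
References: [Shimura1982, (1.31)], [Shimura1997, §16.4], [KudlaRallis1994 (citation only)] — derived here from ★ capital + Mathlib.
HONEST LABEL: HC_CM is proved only modulo the 7 printed citations (2 remaining named inputs: hLiu418 = stmt-HodgeConjecture-24832,
h413 = stmt-HodgeConjecture-24833) until rung 0 closes; count-neutral helper, closes no socket.
-/

set_option autoImplicit false
set_option linter.dupNamespace false

noncomputable section

open Complex Set Matrix Filter
open scoped ComplexConjugate Topology

namespace Summit.HodgeConjecture.HodgeConjecture.Cruxes.HLiu418.K2LiuArchIntertwiningContinuedHalf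

open Literature.NumberTheory.ModularForms.SiegelUpperHalfSpace (denom moeb)
open Summit.HodgeConjecture.HodgeConjecture.Cruxes.HLiu418.K2LiuHermitianTubeCocycle
open Summit.HodgeConjecture.HodgeConjecture.Cruxes.HLiu418.K2LiuArchInducedTubeDefs
open Summit.HodgeConjecture.HodgeConjecture.Cruxes.HLiu418.K2LiuArchNormalisingScalar
open Summit.HodgeConjecture.HodgeConjecture.Cruxes.HLiu418.K2LiuArchNormalisedScalarCont
open Summit.HodgeConjecture.HodgeConjecture.Cruxes.HLiu418.K2LiuArchScalarSectionUnique
open Summit.HodgeConjecture.HodgeConjecture.Cruxes.HLiu418.K2LiuArchIntertwiningRightEquivariance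

/-! ## §0  Holomorphy in the parameter `s` -/

section Generic

variable {l : Type*} [Fintype l] [DecidableEq l]

/-- **`s ↦ f⁰_{s,k}(h)` IS ENTIRE** for `h ∈ U(J)`: `j(h, i1) ≠ 0` on the tube (★ `det_denom_ne_zero`), so `‖j‖^{k−2s−l}` is an exponential
in `s`. [Shimura1997, §16.4] -/
theorem differentiable_archScalarSection_param (k : ℤ) {h : Matrix (l ⊕ l) (l ⊕ l) ℂ}
    (hh : hᴴ * Matrix.J l ℂ * h = Matrix.J l ℂ) :
    Differentiable ℂ (fun s : ℂ => archScalarSection k s h) := by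
  have hd : (denom h (I • (1 : Matrix l l ℂ))).det ≠ 0 := det_denom_ne_zero hh posDef_im_I_smul_one
  have hn : (((‖(denom h (I • (1 : Matrix l l ℂ))).det‖ : ℝ) : ℂ)) ≠ 0 :=
    Complex.ofReal_ne_zero.mpr (norm_ne_zero_iff.mpr hd)
  have hfun : (fun s : ℂ => archScalarSection k s h) = fun s : ℂ =>
      (denom h (I • (1 : Matrix l l ℂ))).det ^ (-k) *
        (((‖(denom h (I • (1 : Matrix l l ℂ))).det‖ : ℝ) : ℂ) ^ ((k : ℂ) - 2 * s - (Fintype.card l : ℂ))) := rfl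
  rw [hfun]
  intro s
  refine (differentiableAt_const _).mul (DifferentiableAt.const_cpow ?_ (Or.inl hn))
  exact ((differentiableAt_const _).sub ((differentiableAt_const _).mul differentiableAt_id)).sub
    (differentiableAt_const _)

/-- `s ↦ f⁰_{−s,k}(h)` is entire (`h ∈ U(J)`). [Shimura1997, §16.4] -/
theorem differentiable_archScalarSection_neg_param (k : ℤ) {h : Matrix (l ⊕ l) (l ⊕ l) ℂ}
    (hh : hᴴ * Matrix.J l ℂ * h = Matrix.J l ℂ) :
    Differentiable ℂ (fun s : ℂ => archScalarSection k (-s) h) :=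
  (differentiable_archScalarSection_param k hh).comp differentiable_neg

end Generic

/-- **THE CLOSED FORM IS HOLOMORPHIC ON `{0 < re s}`** (odd `k`): `s ↦ c · n_k(s) · f⁰_{−s,k}(h)` (★ (L2) `differentiableOn_archNormalisedScalarCont`
and §0). [Shimura1982, (1.31)] -/
theorem differentiableOn_contClosedForm {k : ℤ} (hk : Odd k) (c : ℂ) {h : Matrix (Fin 2 ⊕ Fin 2) (Fin 2 ⊕ Fin 2) ℂ}
    (hh : hᴴ * Matrix.J (Fin 2) ℂ * h = Matrix.J (Fin 2) ℂ) :
    DifferentiableOn ℂ (fun s : ℂ => c * archNormalisedScalarCont k s * archScalarSection k (-s) h) {s : ℂ | 0 < s.re} :=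
  ((differentiableOn_const c).mul (differentiableOn_archNormalisedScalarCont hk)).mul
    (differentiable_archScalarSection_neg_param k hh).differentiableOn

/-! ## §1  The continuation is the closed form on `{0 < re s}` (identity theorem) -/

/-- **ON `re s > ½` THE NORMALISED OPERATOR OF A SCALAR-TYPE FAMILY IS THE CLOSED FORM**: if `F s` has the scalar parabolic law of
`I_w(s, χ_k)`, the scalar `K_w`-type `k` and `F s 1 = c`, then `M*_w(s) (F s) (h) = c · n_k(s) · f⁰_{−s,k}(h)` (`h ∈ U(2,2)`, every `k : ℤ`).
[Shimura1982, (1.31); Shimura1997, §16.4] -/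
theorem archIntertwiningNormalized_eq_contClosedForm (k : ℤ) {c : ℂ} {s : ℂ} (hs : 1 / 2 < s.re)
    {f : Matrix (Fin 2 ⊕ Fin 2) (Fin 2 ⊕ Fin 2) ℂ → ℂ}
    (hP : IsArchSiegelSection (fun z : ℂ => (conj z / ((‖z‖ : ℝ) : ℂ)) ^ k) s f)
    (hK : ∀ g u : Matrix (Fin 2 ⊕ Fin 2) (Fin 2 ⊕ Fin 2) ℂ, gᴴ * Matrix.J (Fin 2) ℂ * g = Matrix.J (Fin 2) ℂ →
      uᴴ * Matrix.J (Fin 2) ℂ * u = Matrix.J (Fin 2) ℂ → moeb u (I • (1 : Matrix (Fin 2) (Fin 2) ℂ)) = I • 1 →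
        f (g * u) = (denom u (I • (1 : Matrix (Fin 2) (Fin 2) ℂ))).det ^ (-k) * f g)
    (hf1 : f 1 = c)
    {h : Matrix (Fin 2 ⊕ Fin 2) (Fin 2 ⊕ Fin 2) ℂ} (hh : hᴴ * Matrix.J (Fin 2) ℂ * h = Matrix.J (Fin 2) ℂ) :
    archIntertwiningNormalized s f h = c * archNormalisedScalarCont k s * archScalarSection k (-s) h := by
  have hf : ∀ g : Matrix (Fin 2 ⊕ Fin 2) (Fin 2 ⊕ Fin 2) ℂ, gᴴ * Matrix.J (Fin 2) ℂ * g = Matrix.J (Fin 2) ℂ →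
      f g = f 1 * archScalarSection k s g := fun g hg => eq_mul_archScalarSection (l := Fin 2) k s hP hK hg
  have hL := archIntertwiningNormalized_archScalarSection_eq_cont k hs hh
  rw [archIntertwiningNormalized_apply] at hL
  rw [archIntertwiningNormalized_apply, archIntertwining_eq_mul (l := Fin 2) k s hf hh, hf1, mul_assoc c, ← hL]
  ring

/-- **THE CONTINUATION IS THE CLOSED FORM ON THE WHOLE OF `{0 < re s}`** (odd `k`): for a family `F s` with the scalar parabolic law, the
scalar `K_w`-type `k` and the flat normalisation `F s 1 = c` on `½ < re s`, every `Fn` holomorphic on `{0 < re s}` which agrees with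
`M*_w(s) (F s) (h)` on `½ < re s` equals `c · n_k(s) · f⁰_{−s,k}(h)` at every `s` with `0 < re s` (identity theorem on the convex half-plane).
[Shimura1982, (1.31); KudlaRallis1994 (citation only)] -/
theorem eq_contClosedForm_of_re_pos {k : ℤ} (hk : Odd k) {c : ℂ} {h : Matrix (Fin 2 ⊕ Fin 2) (Fin 2 ⊕ Fin 2) ℂ}
    (hh : hᴴ * Matrix.J (Fin 2) ℂ * h = Matrix.J (Fin 2) ℂ) {F : ℂ → Matrix (Fin 2 ⊕ Fin 2) (Fin 2 ⊕ Fin 2) ℂ → ℂ}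
    (hP : ∀ s : ℂ, 1 / 2 < s.re → IsArchSiegelSection (fun z : ℂ => (conj z / ((‖z‖ : ℝ) : ℂ)) ^ k) s (F s))
    (hK : ∀ s : ℂ, 1 / 2 < s.re → ∀ g u : Matrix (Fin 2 ⊕ Fin 2) (Fin 2 ⊕ Fin 2) ℂ,
      gᴴ * Matrix.J (Fin 2) ℂ * g = Matrix.J (Fin 2) ℂ → uᴴ * Matrix.J (Fin 2) ℂ * u = Matrix.J (Fin 2) ℂ →
        moeb u (I • (1 : Matrix (Fin 2) (Fin 2) ℂ)) = I • 1 →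
          F s (g * u) = (denom u (I • (1 : Matrix (Fin 2) (Fin 2) ℂ))).det ^ (-k) * F s g)
    (hF1 : ∀ s : ℂ, 1 / 2 < s.re → F s 1 = c)
    {Fn : ℂ → ℂ} (hFn : DifferentiableOn ℂ Fn {s : ℂ | 0 < s.re})
    (hagree : ∀ s : ℂ, 1 / 2 < s.re → Fn s = archIntertwiningNormalized s (F s) h)
    {s : ℂ} (hs : 0 < s.re) :
    Fn s = c * archNormalisedScalarCont k s * archScalarSection k (-s) h := by
  have hhalf : ∀ s : ℂ, 1 / 2 < s.re → Fn s = c * archNormalisedScalarCont k s * archScalarSection k (-s) h :=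
    fun s hs' => by
      rw [hagree s hs']
      exact archIntertwiningNormalized_eq_contClosedForm k hs' (hP s hs') (hK s hs') (hF1 s hs') hh
  have hUo : IsOpen {s : ℂ | 0 < s.re} := isOpen_lt continuous_const Complex.continuous_re
  have hUc : IsPreconnected {s : ℂ | 0 < s.re} := (convex_halfSpace_re_gt (0 : ℝ)).isPreconnected
  have h1U : (1 : ℂ) ∈ {s : ℂ | 0 < s.re} := by
    simp only [mem_setOf_eq, Complex.one_re]
    norm_num
  have hev : Fn =ᶠ[𝓝 (1 : ℂ)] fun s => c * archNormalisedScalarCont k s * archScalarSection k (-s) h := by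
    have hO : IsOpen {s : ℂ | 1 / 2 < s.re} := isOpen_lt continuous_const Complex.continuous_re
    have h1 : (1 : ℂ) ∈ {s : ℂ | 1 / 2 < s.re} := by
      simp only [mem_setOf_eq, Complex.one_re]
      norm_num
    exact Filter.eventuallyEq_of_mem (hO.mem_nhds h1) fun s hs' => hhalf s hs'
  exact (hFn.analyticOnNhd hUo).eqOn_of_preconnected_of_eventuallyEq
    ((differentiableOn_contClosedForm hk c hh).analyticOnNhd hUo) hUc h1U hev hs

/-! ## §2  The faces at `s = ½` -/

/-- `re (½) = ½ > 0`. [folklore] -/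
theorem one_half_re_pos : 0 < (1 / 2 : ℂ).re := by
  rw [Complex.div_ofNat_re, Complex.one_re]
  norm_num

/-- **(A∞-½) ∕ U1-arch KERNEL FACE**: on an odd scalar `K_w`-type `k` with `|k| ≠ 1`, EVERY holomorphic continuation to `{0 < re s}` of
`s ↦ M*_w(s) (F s) (h)` VANISHES at `s = ½` (`F s` the flat scalar-type family through `F (½)`: parabolic law, `K_w`-type `k`, `F s 1 = c`).
This is the arch clause of U1-glob(σ) on scalar weights, by name (★ (L3b) `archNormalisedScalarCont_half_eq_zero`). [Shimura1982, (1.31)] -/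
theorem half_eq_zero {k : ℤ} (hk : Odd k) (h1 : k.natAbs ≠ 1) {c : ℂ} {h : Matrix (Fin 2 ⊕ Fin 2) (Fin 2 ⊕ Fin 2) ℂ}
    (hh : hᴴ * Matrix.J (Fin 2) ℂ * h = Matrix.J (Fin 2) ℂ) {F : ℂ → Matrix (Fin 2 ⊕ Fin 2) (Fin 2 ⊕ Fin 2) ℂ → ℂ}
    (hP : ∀ s : ℂ, 1 / 2 < s.re → IsArchSiegelSection (fun z : ℂ => (conj z / ((‖z‖ : ℝ) : ℂ)) ^ k) s (F s))
    (hK : ∀ s : ℂ, 1 / 2 < s.re → ∀ g u : Matrix (Fin 2 ⊕ Fin 2) (Fin 2 ⊕ Fin 2) ℂ,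
      gᴴ * Matrix.J (Fin 2) ℂ * g = Matrix.J (Fin 2) ℂ → uᴴ * Matrix.J (Fin 2) ℂ * u = Matrix.J (Fin 2) ℂ →
        moeb u (I • (1 : Matrix (Fin 2) (Fin 2) ℂ)) = I • 1 →
          F s (g * u) = (denom u (I • (1 : Matrix (Fin 2) (Fin 2) ℂ))).det ^ (-k) * F s g)
    (hF1 : ∀ s : ℂ, 1 / 2 < s.re → F s 1 = c)
    {Fn : ℂ → ℂ} (hFn : DifferentiableOn ℂ Fn {s : ℂ | 0 < s.re})
    (hagree : ∀ s : ℂ, 1 / 2 < s.re → Fn s = archIntertwiningNormalized s (F s) h) :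
    Fn (1 / 2) = 0 := by
  rw [eq_contClosedForm_of_re_pos hk hh hP hK hF1 hFn hagree one_half_re_pos, archNormalisedScalarCont_half_eq_zero hk h1,
    mul_zero, zero_mul]

/-- `|k| = 1 ⇒ k` odd. [folklore] -/
theorem odd_of_natAbs_eq_one {k : ℤ} (h1 : k.natAbs = 1) : Odd k := by
  rw [← Int.natAbs_odd, h1]
  exact odd_one

/-- **(A∞-R) ∕ (A-int-arch) FACE AT `½` ON THE PINNED GAUSSIAN LINE TYPES `k = ±1`**: every holomorphic continuation to `{0 < re s}` of
`s ↦ M*_w(s) (F s) (h)` takes the value `c · f⁰_{−½,k}(h)` at `s = ½` — `M*_σ(½) f = f(1) · f⁰_{−½,±1}` (★ (L3a)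
`archNormalisedScalarCont_half_of_natAbs_eq_one`; Kudla–Rallis pinning). [KudlaRallis1994 (citation only); Shimura1982, (1.31)] -/
theorem half_eq_of_natAbs_eq_one {k : ℤ} (h1 : k.natAbs = 1) {c : ℂ} {h : Matrix (Fin 2 ⊕ Fin 2) (Fin 2 ⊕ Fin 2) ℂ}
    (hh : hᴴ * Matrix.J (Fin 2) ℂ * h = Matrix.J (Fin 2) ℂ) {F : ℂ → Matrix (Fin 2 ⊕ Fin 2) (Fin 2 ⊕ Fin 2) ℂ → ℂ}
    (hP : ∀ s : ℂ, 1 / 2 < s.re → IsArchSiegelSection (fun z : ℂ => (conj z / ((‖z‖ : ℝ) : ℂ)) ^ k) s (F s))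
    (hK : ∀ s : ℂ, 1 / 2 < s.re → ∀ g u : Matrix (Fin 2 ⊕ Fin 2) (Fin 2 ⊕ Fin 2) ℂ,
      gᴴ * Matrix.J (Fin 2) ℂ * g = Matrix.J (Fin 2) ℂ → uᴴ * Matrix.J (Fin 2) ℂ * u = Matrix.J (Fin 2) ℂ →
        moeb u (I • (1 : Matrix (Fin 2) (Fin 2) ℂ)) = I • 1 →
          F s (g * u) = (denom u (I • (1 : Matrix (Fin 2) (Fin 2) ℂ))).det ^ (-k) * F s g)
    (hF1 : ∀ s : ℂ, 1 / 2 < s.re → F s 1 = c)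
    {Fn : ℂ → ℂ} (hFn : DifferentiableOn ℂ Fn {s : ℂ | 0 < s.re})
    (hagree : ∀ s : ℂ, 1 / 2 < s.re → Fn s = archIntertwiningNormalized s (F s) h) :
    Fn (1 / 2) = c * archScalarSection k (-(1 / 2)) h := by
  rw [eq_contClosedForm_of_re_pos (odd_of_natAbs_eq_one h1) hh hP hK hF1 hFn hagree one_half_re_pos,
    archNormalisedScalarCont_half_of_natAbs_eq_one h1, mul_one]

/-- **THE VALUE AT `½` FOR EVERY ODD SCALAR TYPE, BY THE CONTINUED NAME**: `Fn (½) = c · n_k(½) · f⁰_{−½,k}(h)`. [Shimura1982, (1.31)] -/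
theorem half_eq {k : ℤ} (hk : Odd k) {c : ℂ} {h : Matrix (Fin 2 ⊕ Fin 2) (Fin 2 ⊕ Fin 2) ℂ}
    (hh : hᴴ * Matrix.J (Fin 2) ℂ * h = Matrix.J (Fin 2) ℂ) {F : ℂ → Matrix (Fin 2 ⊕ Fin 2) (Fin 2 ⊕ Fin 2) ℂ → ℂ}
    (hP : ∀ s : ℂ, 1 / 2 < s.re → IsArchSiegelSection (fun z : ℂ => (conj z / ((‖z‖ : ℝ) : ℂ)) ^ k) s (F s))
    (hK : ∀ s : ℂ, 1 / 2 < s.re → ∀ g u : Matrix (Fin 2 ⊕ Fin 2) (Fin 2 ⊕ Fin 2) ℂ,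
      gᴴ * Matrix.J (Fin 2) ℂ * g = Matrix.J (Fin 2) ℂ → uᴴ * Matrix.J (Fin 2) ℂ * u = Matrix.J (Fin 2) ℂ →
        moeb u (I • (1 : Matrix (Fin 2) (Fin 2) ℂ)) = I • 1 →
          F s (g * u) = (denom u (I • (1 : Matrix (Fin 2) (Fin 2) ℂ))).det ^ (-k) * F s g)
    (hF1 : ∀ s : ℂ, 1 / 2 < s.re → F s 1 = c)
    {Fn : ℂ → ℂ} (hFn : DifferentiableOn ℂ Fn {s : ℂ | 0 < s.re})
    (hagree : ∀ s : ℂ, 1 / 2 < s.re → Fn s = archIntertwiningNormalized s (F s) h) :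
    Fn (1 / 2) = c * archNormalisedScalarCont k (1 / 2) * archScalarSection k (-(1 / 2)) h :=
  eq_contClosedForm_of_re_pos hk hh hP hK hF1 hFn hagree one_half_re_pos

/-! ## §3  The explicit flat family `F s = c · f⁰_{s,k}` and the function-level corollaries -/

/-- **EXPLICIT FAMILY, CLOSED FORM ON `{0 < re s}`** (odd `k`): for `F s = c · f⁰_{s,k}` nothing is left to discharge —
every holomorphic `Fn` on `{0 < re s}` with `Fn s = M*_w(s) (c · f⁰_{s,k}) (h)` on `½ < re s` is `c · n_k(s) · f⁰_{−s,k}(h)` there.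
[Shimura1982, (1.31)] -/
theorem eq_contClosedForm_of_re_pos_archScalarSection {k : ℤ} (hk : Odd k) (c : ℂ)
    {h : Matrix (Fin 2 ⊕ Fin 2) (Fin 2 ⊕ Fin 2) ℂ} (hh : hᴴ * Matrix.J (Fin 2) ℂ * h = Matrix.J (Fin 2) ℂ)
    {Fn : ℂ → ℂ} (hFn : DifferentiableOn ℂ Fn {s : ℂ | 0 < s.re})
    (hagree : ∀ s : ℂ, 1 / 2 < s.re → Fn s = archIntertwiningNormalized s (fun g => c * archScalarSection k s g) h)
    {s : ℂ} (hs : 0 < s.re) :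
    Fn s = c * archNormalisedScalarCont k s * archScalarSection k (-s) h := by
  have hhalf : ∀ s : ℂ, 1 / 2 < s.re → Fn s = c * archNormalisedScalarCont k s * archScalarSection k (-s) h :=
    fun s hs' => by
      have hL := archIntertwiningNormalized_archScalarSection_eq_cont k hs' hh
      rw [archIntertwiningNormalized_apply] at hL
      rw [hagree s hs', archIntertwiningNormalized_apply, archIntertwining_const_mul, mul_assoc c, ← hL]
      ring
  have hUo : IsOpen {s : ℂ | 0 < s.re} := isOpen_lt continuous_const Complex.continuous_re
  have hUc : IsPreconnected {s : ℂ | 0 < s.re} := (convex_halfSpace_re_gt (0 : ℝ)).isPreconnected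
  have h1U : (1 : ℂ) ∈ {s : ℂ | 0 < s.re} := by
    simp only [mem_setOf_eq, Complex.one_re]
    norm_num
  have hev : Fn =ᶠ[𝓝 (1 : ℂ)] fun s => c * archNormalisedScalarCont k s * archScalarSection k (-s) h := by
    have hO : IsOpen {s : ℂ | 1 / 2 < s.re} := isOpen_lt continuous_const Complex.continuous_re
    have h1 : (1 : ℂ) ∈ {s : ℂ | 1 / 2 < s.re} := by
      simp only [mem_setOf_eq, Complex.one_re]
      norm_num
    exact Filter.eventuallyEq_of_mem (hO.mem_nhds h1) fun s hs' => hhalf s hs'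
  exact (hFn.analyticOnNhd hUo).eqOn_of_preconnected_of_eventuallyEq
    ((differentiableOn_contClosedForm hk c hh).analyticOnNhd hUo) hUc h1U hev hs

/-- **EXPLICIT FAMILY, (A∞-½) KERNEL FACE**: odd `|k| ≠ 1` ⇒ the continuation of `s ↦ M*_w(s) (c · f⁰_{s,k}) (h)` vanishes at `½`.
[Shimura1982, (1.31)] -/
theorem half_eq_zero_archScalarSection {k : ℤ} (hk : Odd k) (h1 : k.natAbs ≠ 1) (c : ℂ)
    {h : Matrix (Fin 2 ⊕ Fin 2) (Fin 2 ⊕ Fin 2) ℂ} (hh : hᴴ * Matrix.J (Fin 2) ℂ * h = Matrix.J (Fin 2) ℂ)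
    {Fn : ℂ → ℂ} (hFn : DifferentiableOn ℂ Fn {s : ℂ | 0 < s.re})
    (hagree : ∀ s : ℂ, 1 / 2 < s.re → Fn s = archIntertwiningNormalized s (fun g => c * archScalarSection k s g) h) :
    Fn (1 / 2) = 0 := by
  rw [eq_contClosedForm_of_re_pos_archScalarSection hk c hh hFn hagree one_half_re_pos,
    archNormalisedScalarCont_half_eq_zero hk h1, mul_zero, zero_mul]

/-- **EXPLICIT FAMILY, (A∞-R) FACE AT `½` ON `k = ±1`**: the continuation of `s ↦ M*_w(s) (c · f⁰_{s,k}) (h)` equals `c · f⁰_{−½,k}(h)` at `½`.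
[KudlaRallis1994 (citation only); Shimura1982, (1.31)] -/
theorem half_eq_archScalarSection_of_natAbs_eq_one {k : ℤ} (h1 : k.natAbs = 1) (c : ℂ)
    {h : Matrix (Fin 2 ⊕ Fin 2) (Fin 2 ⊕ Fin 2) ℂ} (hh : hᴴ * Matrix.J (Fin 2) ℂ * h = Matrix.J (Fin 2) ℂ)
    {Fn : ℂ → ℂ} (hFn : DifferentiableOn ℂ Fn {s : ℂ | 0 < s.re})
    (hagree : ∀ s : ℂ, 1 / 2 < s.re → Fn s = archIntertwiningNormalized s (fun g => c * archScalarSection k s g) h) :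
    Fn (1 / 2) = c * archScalarSection k (-(1 / 2)) h := by
  rw [eq_contClosedForm_of_re_pos_archScalarSection (odd_of_natAbs_eq_one h1) c hh hFn hagree one_half_re_pos,
    archNormalisedScalarCont_half_of_natAbs_eq_one h1, mul_one]

/-- **FUNCTION-LEVEL (A∞-½) KERNEL FACE**: for a continuation `Fn : ℂ → (M₄(ℂ) → ℂ)` of the normalised operator of a flat scalar-type
family (odd `|k| ≠ 1`), holomorphic in `s` on `{0 < re s}` at every `h ∈ U(J)`, the value `Fn (½)` VANISHES ON `U(2,2)`. [Shimura1982, (1.31)] -/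
theorem half_apply_eq_zero {k : ℤ} (hk : Odd k) (h1 : k.natAbs ≠ 1) {c : ℂ}
    {F : ℂ → Matrix (Fin 2 ⊕ Fin 2) (Fin 2 ⊕ Fin 2) ℂ → ℂ}
    (hP : ∀ s : ℂ, 1 / 2 < s.re → IsArchSiegelSection (fun z : ℂ => (conj z / ((‖z‖ : ℝ) : ℂ)) ^ k) s (F s))
    (hK : ∀ s : ℂ, 1 / 2 < s.re → ∀ g u : Matrix (Fin 2 ⊕ Fin 2) (Fin 2 ⊕ Fin 2) ℂ,
      gᴴ * Matrix.J (Fin 2) ℂ * g = Matrix.J (Fin 2) ℂ → uᴴ * Matrix.J (Fin 2) ℂ * u = Matrix.J (Fin 2) ℂ →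
        moeb u (I • (1 : Matrix (Fin 2) (Fin 2) ℂ)) = I • 1 →
          F s (g * u) = (denom u (I • (1 : Matrix (Fin 2) (Fin 2) ℂ))).det ^ (-k) * F s g)
    (hF1 : ∀ s : ℂ, 1 / 2 < s.re → F s 1 = c)
    {Fn : ℂ → Matrix (Fin 2 ⊕ Fin 2) (Fin 2 ⊕ Fin 2) ℂ → ℂ}
    (hFn : ∀ h : Matrix (Fin 2 ⊕ Fin 2) (Fin 2 ⊕ Fin 2) ℂ, hᴴ * Matrix.J (Fin 2) ℂ * h = Matrix.J (Fin 2) ℂ →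
      DifferentiableOn ℂ (fun s => Fn s h) {s : ℂ | 0 < s.re})
    (hagree : ∀ s : ℂ, 1 / 2 < s.re → ∀ h : Matrix (Fin 2 ⊕ Fin 2) (Fin 2 ⊕ Fin 2) ℂ,
      hᴴ * Matrix.J (Fin 2) ℂ * h = Matrix.J (Fin 2) ℂ → Fn s h = archIntertwiningNormalized s (F s) h)
    {h : Matrix (Fin 2 ⊕ Fin 2) (Fin 2 ⊕ Fin 2) ℂ} (hh : hᴴ * Matrix.J (Fin 2) ℂ * h = Matrix.J (Fin 2) ℂ) :
    Fn (1 / 2) h = 0 :=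
  half_eq_zero hk h1 hh hP hK hF1 (hFn h hh) (fun s hs => hagree s hs h hh)

/-- **FUNCTION-LEVEL (A∞-R) FACE AT `½` (`k = ±1`)**: `Fn (½) = c · f⁰_{−½,k}` on `U(2,2)` — the continued normalised operator maps the
flat Gaussian-line-type family through `f` to `f(1) · f⁰_{−½,±1}`. [KudlaRallis1994 (citation only); Shimura1982, (1.31)] -/
theorem half_apply_eq_of_natAbs_eq_one {k : ℤ} (h1 : k.natAbs = 1) {c : ℂ}
    {F : ℂ → Matrix (Fin 2 ⊕ Fin 2) (Fin 2 ⊕ Fin 2) ℂ → ℂ}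
    (hP : ∀ s : ℂ, 1 / 2 < s.re → IsArchSiegelSection (fun z : ℂ => (conj z / ((‖z‖ : ℝ) : ℂ)) ^ k) s (F s))
    (hK : ∀ s : ℂ, 1 / 2 < s.re → ∀ g u : Matrix (Fin 2 ⊕ Fin 2) (Fin 2 ⊕ Fin 2) ℂ,
      gᴴ * Matrix.J (Fin 2) ℂ * g = Matrix.J (Fin 2) ℂ → uᴴ * Matrix.J (Fin 2) ℂ * u = Matrix.J (Fin 2) ℂ →
        moeb u (I • (1 : Matrix (Fin 2) (Fin 2) ℂ)) = I • 1 →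
          F s (g * u) = (denom u (I • (1 : Matrix (Fin 2) (Fin 2) ℂ))).det ^ (-k) * F s g)
    (hF1 : ∀ s : ℂ, 1 / 2 < s.re → F s 1 = c)
    {Fn : ℂ → Matrix (Fin 2 ⊕ Fin 2) (Fin 2 ⊕ Fin 2) ℂ → ℂ}
    (hFn : ∀ h : Matrix (Fin 2 ⊕ Fin 2) (Fin 2 ⊕ Fin 2) ℂ, hᴴ * Matrix.J (Fin 2) ℂ * h = Matrix.J (Fin 2) ℂ →
      DifferentiableOn ℂ (fun s => Fn s h) {s : ℂ | 0 < s.re})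
    (hagree : ∀ s : ℂ, 1 / 2 < s.re → ∀ h : Matrix (Fin 2 ⊕ Fin 2) (Fin 2 ⊕ Fin 2) ℂ,
      hᴴ * Matrix.J (Fin 2) ℂ * h = Matrix.J (Fin 2) ℂ → Fn s h = archIntertwiningNormalized s (F s) h)
    {h : Matrix (Fin 2 ⊕ Fin 2) (Fin 2 ⊕ Fin 2) ℂ} (hh : hᴴ * Matrix.J (Fin 2) ℂ * h = Matrix.J (Fin 2) ℂ) :
    Fn (1 / 2) h = c * archScalarSection k (-(1 / 2)) h :=
  half_eq_of_natAbs_eq_one h1 hh hP hK hF1 (hFn h hh) (fun s hs => hagree s hs h hh)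

/-- **UNIQUENESS OF THE CONTINUED VALUE** (odd `k`): two holomorphic continuations to `{0 < re s}` of the normalised operator of the same
flat scalar-type family agree on `{0 < re s}` — the consumer's `Fn` is whatever continuation #41 hands it. [folklore; Shimura1982, (1.31)] -/
theorem continuations_eq_of_re_pos {k : ℤ} (hk : Odd k) {c : ℂ} {h : Matrix (Fin 2 ⊕ Fin 2) (Fin 2 ⊕ Fin 2) ℂ}
    (hh : hᴴ * Matrix.J (Fin 2) ℂ * h = Matrix.J (Fin 2) ℂ) {F : ℂ → Matrix (Fin 2 ⊕ Fin 2) (Fin 2 ⊕ Fin 2) ℂ → ℂ}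
    (hP : ∀ s : ℂ, 1 / 2 < s.re → IsArchSiegelSection (fun z : ℂ => (conj z / ((‖z‖ : ℝ) : ℂ)) ^ k) s (F s))
    (hK : ∀ s : ℂ, 1 / 2 < s.re → ∀ g u : Matrix (Fin 2 ⊕ Fin 2) (Fin 2 ⊕ Fin 2) ℂ,
      gᴴ * Matrix.J (Fin 2) ℂ * g = Matrix.J (Fin 2) ℂ → uᴴ * Matrix.J (Fin 2) ℂ * u = Matrix.J (Fin 2) ℂ →
        moeb u (I • (1 : Matrix (Fin 2) (Fin 2) ℂ)) = I • 1 →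
          F s (g * u) = (denom u (I • (1 : Matrix (Fin 2) (Fin 2) ℂ))).det ^ (-k) * F s g)
    (hF1 : ∀ s : ℂ, 1 / 2 < s.re → F s 1 = c)
    {Fn Fn' : ℂ → ℂ} (hFn : DifferentiableOn ℂ Fn {s : ℂ | 0 < s.re}) (hFn' : DifferentiableOn ℂ Fn' {s : ℂ | 0 < s.re})
    (hagree : ∀ s : ℂ, 1 / 2 < s.re → Fn s = archIntertwiningNormalized s (F s) h)
    (hagree' : ∀ s : ℂ, 1 / 2 < s.re → Fn' s = archIntertwiningNormalized s (F s) h)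
    {s : ℂ} (hs : 0 < s.re) :
    Fn s = Fn' s := by
  rw [eq_contClosedForm_of_re_pos hk hh hP hK hF1 hFn hagree hs, eq_contClosedForm_of_re_pos hk hh hP hK hF1 hFn' hagree' hs]

end Summit.HodgeConjecture.HodgeConjecture.Cruxes.HLiu418.K2LiuArchIntertwiningContinuedHalf

end
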